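import Summits.QuantumFields.BalabanUV.Beta.FP.RoadPinnedHolds
import Summits.QuantumFields.BalabanUV.Beta.GAN24.SlotRowsPowBase

/-!
# `BalabanUV.Beta.FP.RoadRebasedHolds` — road «FP» for binder row D1: THE ROAD's END FOR THE PINNED FAMILY WITH THE (j,m) JET FAMILIES OF RECORD
# (R-FP-8: REBASED WALL FAMILIES) — the `m ≥ 2` class data `hSinf` / `hWinf` DISCHARGED BY NAME (`d = 3`, every `Lc ≥ 2`, `r ∈ box (3+1) Lc`)

Owner's integration step (road FP owner b2b-balaban-beta-d1-p3, gen 2; `HOME/b2b-balaban-beta-d1-p3/OWNER-RULINGS-FP-1.md` ruling R-FP-8 = row G-an2-4's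
option (a)).  `FP/RoadPinnedHolds` (leaf-06 g3, p217323) reads road FP's END for an2's PINNED Stage-B family `JsBalT2Of … ((Lc:ℝ)^(2*(3+1))) cB Tc …` with the
K-, S- and W-slot rows of row G-an2-4 discharged; its residual list still displayed the limit-currency class data of the (j, m) jet families for `m ≥ 2`
(`hSinf`, `hWinf` = sub-rows X1m-S / X1m-W of `LEAVES-FP.md`).  By R-FP-8 the families OF RECORD are the REBASED wall families: member `m` of `S` / `Wt` is
ONE wall step at base `Lc^m` embedded at `j = m·j′` with unit compensation (`FP/RebaseJets.rebaseS` / `rebaseW`, p219985), member `1` is the base-`Lc` family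
itself (pins `hS1` / `hW1`).  Row G-an2-4 has delivered the slot rows AT BASE `Lc^m` and the plugs into road FP's `SPerfOf` / `WPerfOf` currency
(`GAN24/SlotRowsPowBase.locStencil_SPerfOf_rebase_pow` / `vertexFamily₂_WPerfOf_rebase_pow`, gan24-p1-g7, p220401).  This module composes them:

* §1 `hSinf_of_rebase` / `hWinf_of_rebase`: for families `S`, `Wt` whose member-`m` columns (`m ≥ 2`) are rebased base-`Lc^m` wall families (S-side: of ANY
  table family with `VertexFamily₂` data at blocking `Lc^m`; W-side: the Stage-B family PINNED AT BASE `Lc^m`, `cE₂ := ((Lc^m:ℕ):ℝ)^(2*(3+1))`, base border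
  `vh₂S 3 (Lc^m)`, an1's mixed table `mixFFAt (toSite r) (Lc^m)` — the base-`Lc` root `r` is a base-`Lc^m` root, `SlotRowsPowBase.mem_box_pow`), the binders
  `hSinf` / `hWinf` of `FP/StepLawKHolds.d1Drift_JsBalOf_of_rows_bounded` HOLD — no hypothesis beyond `2 ≤ Lc`, `r ∈ box (3+1) Lc`.
* §2 THE END OF RECORD RE-READ: `fPerf_succ_of_rows_rebased`, `d1Drift_JsBalT2Of_pinned_of_rows_rebased`, `endpointExistence_JsBalT2Of_pinned_of_rows_rebased` =
  `RoadPinnedHolds.fPerf_succ_of_rows_pinned` / `d1Drift_JsBalT2Of_pinned_of_rows_bounded` / `endpointExistence_JsBalT2Of_pinned_of_rows_bounded` with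
  `hSinf` / `hWinf` REPLACED by the rebase equations `hSm` / `hWm`.
* §3 `exists_rebased_families`: families `S`, `Wt` satisfying the pins AND the rebase equations EXIST (defined by cases on `m`; non-vacuity of §2's shape).

RESULT (§2, `2 ≤ Lc`, `r ∈ box (3+1) Lc`, families of record): `D1Drift Lc (JsBalT2Of …) N μ ν` ⟸ EXACTLY {the finite-`j` rows `hRj` (an2's hR) / `hWj` (an1's hW)
FOR THIS COMPOSITE FAMILY, the fixed-point Fubini identity `hfub` + `hDA` (leaf N2a), (SDF)∞ `hSDF` (leaf N2b) — which by R-FP-8 now carry ALL «m perfect steps at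
base Lc = one perfect step at base Lc^m» content (REBASE identity + two-fold (SDF), socket `FP/StepDefectInherit`) —, the leading-log asymptotics `hasym` (leaf N7)}.
No K-, S- or W-slot row, no (CONV-C) binder, no class datum of any (j, m) family remains.

HONEST FRAMING (cell contract, verbatim): «discharging `BetaPertH` makes Bałaban's UV stability UNCONDITIONAL — a real constructive-QFT result; it is NOT the
continuum limit and NOT the Clay problem.»  THIS MODULE IS A COMPOSITION over tree ENDs; it proves no estimate.  The rows `hRj` / `hWj` are HYPOTHESES here (an2 /
an1 prove them for the RECURSIVE literal `JsRecWAtOf`, bridge = D1Tel, Q-G5-1 open); `hfub`/`hDA`/`hSDF`/`hasym` are OPEN leaves of road FP.  HEADLINE: «road FP's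
END for the pinned family with the families of record needs no class datum and nothing from row G-an2-4» — NOT «D1 closed», NOT «G-an2-4 closed» (as (CONV-C) for
`G_k, H_k`), NOT BetaPertH, NOT continuum, NOT Clay; 0 wall binders instantiated at a value; binders 0/4 (hW, hR, D1Tel, D1Rep).
Claim table `HOME/b2b-balaban-beta-d1-p3/LEAVES-FP.md` rows X1m-S / X1m-W / R-FP-8 (owner).
HONEST DEPENDENCY (verbatim): «continuum YM on T⁴ ⇐ BetaPertH ∧ nine spine estimates (0/9 proved); BetaPertH ⇐ (D1) ∧ (D4) ∧ CAP+tail; G-an2-4 gates asym,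
D1 and NE2/3/4.»
ABSOLUTE RULE (cell, verbatim): «No internally-minted statement may enter as a cited fact. Every hypothesis is either kernel-proved in this package or a verbatim
quotation of a PUBLISHED theorem with page reference.»  Nothing is cited; no `def`; every input is a tree theorem imported BY NAME; nothing of gan24-p1's,
leaf-06's or this lineage's earlier files is restated.
-/

namespace Summit.QuantumFields.BalabanUV.Beta.FP.RoadRebasedHolds

open Filter Topology
open Literature.MathematicalPhysics.QuantumFieldTheory
open Literature.MathematicalPhysics.QuantumFieldTheory.Balaban1983to89
open Literature.MathematicalPhysics.QuantumFieldTheory.Balaban1983to89.Beta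
open B12Beta (secondMoment)
open B12Normalization (stepBal)
open AffineAveraging (box toSite)
open DecimatedMomentSummable (AbsMoment₂)
open DressedMomentNormalisation (EKer dressedEntry)
open ExpKernelCalculus (MKer Decays VertexFamily₂)
open PolarizationSign (WardTransversal AxisReflectionCovariant)
open OneStepResolventKernel (Fib LocStencil)
open OneStepKernelFamily (KInvStep TbalOf flipK D1Drift)
open BalabanStepJetsSucc (JsBal0Of JsBalOf)
open BalabanStepW2 (WbalOf T2Of T2Of_loc CwOf δwOf δwOf_pos WbalOf_loc₂ JsBalT2Of)
open AveragingMixedJetTables (vh₂S mixFFAt)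
open FlowStep FlowStepRuns DagBinding
open RemainderChain (RemainderConst)
open Summit.QuantumFields.BalabanUV.Beta.HessKerDressedUnits (unitK unitS unitW)
open Summit.QuantumFields.BalabanUV.Beta.MixedJetTablesPlug (hmix_an1)
open Summit.QuantumFields.BalabanUV.Beta.GAN24.CombesThomas (sfStep smStep)
open Summit.QuantumFields.BalabanUV.Beta.GAN24.StencilSlotOfE3 (one_le_of_two_le)
open Summit.QuantumFields.BalabanUV.Beta.GAN24.WSlotT2Tables (hB_base)
open Summit.QuantumFields.BalabanUV.Beta.GAN24.SlotRowsPowBase (mem_box_pow locStencil_SPerfOf_rebase_pow vertexFamily₂_WPerfOf_rebase_pow)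
open Summit.QuantumFields.BalabanUV.Beta.FP.PerfectRebase (two_le_pow)
open Summit.QuantumFields.BalabanUV.Beta.FP.RebaseJets (rebaseS rebaseW)
open Summit.QuantumFields.BalabanUV.Beta.FP.PerfectObjectsT (KPerf SPerfOf WPerfOf TPerfOf fPerf)
open Summit.QuantumFields.BalabanUV.Beta.FP.TransportInfinityM (colOf)
open Summit.QuantumFields.BalabanUV.Beta.FP.RoadPinnedHolds (fPerf_succ_of_rows_pinned d1Drift_JsBalT2Of_pinned_of_rows_bounded
  endpointExistence_JsBalT2Of_pinned_of_rows_bounded)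

noncomputable section

variable {Lc : ℕ} [NeZero Lc] {r : Fin (3 + 1) → ℕ} (hr : r ∈ box (3 + 1) Lc) (cE cVH cΛ cB : ℝ) (Tc : Fin 4 → Fin 4 → Fin 4 → Fin 4 → ℝ)
  (S : ℕ → ℕ → Fin (3 + 1) → (Fin (3 + 1) → ℤ) → MKer (3 + 1) (Fib 3))
  (Wt : ℕ → ℕ → Fin (3 + 1) → (Fin (3 + 1) → ℤ) → Fin (3 + 1) → (Fin (3 + 1) → ℤ) → MKer (3 + 1) (Fib 3))
  {D : ℕ → EKer 4}

/-! ## §1 The `m ≥ 2` class data of the families of record, BY REBASE (X1m-S / X1m-W closed for the rebased families) -/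

/-- **`hSinf` BY REBASE, EVERY `m ≥ 2`** (`2 ≤ Lc`): if each member-`m` column of the (j, m) stencil family `S` (`m ≥ 2`) is the REBASED stencil family of SOME
base-`Lc^m` wall step `JsBal0Of (Lc := Lc^m) … W …` (any second-order table family `W` with `VertexFamily₂` data at blocking `Lc^m`), then the perfect stencils
`SPerfOf (sfStep Lc) (smStep 3 Lc) S m` are local stencil families — the binder `hSinf` of `FP/StepLawKHolds.d1Drift_JsBalOf_of_rows_bounded`.
`SlotRowsPowBase.locStencil_SPerfOf_rebase_pow` per `m`. [our object] composition. -/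
theorem hSinf_of_rebase (hLc2 : 2 ≤ Lc)
    (hSm : ∀ m : ℕ, 2 ≤ m → ∃ (W : ℕ → Fin (3 + 1) → (Fin (3 + 1) → ℤ) → Fin (3 + 1) → (Fin (3 + 1) → ℤ) → MKer (3 + 1) (Fib 3))
      (Cw δw : ℕ → ℝ) (hδw : ∀ j, 0 < δw j) (hW' : ∀ j, VertexFamily₂ (W j) (Lc ^ m) (Cw j) (δw j)) (h1 : 1 ≤ Lc ^ m),
      ∀ j, S j m = rebaseS Lc m (fun j' => (JsBal0Of h1 cE cVH cΛ W Cw δw hδw hW' j').S) j) :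
    ∀ m : ℕ, 2 ≤ m → ∃ Cs' δS' : ℝ, 0 < δS' ∧ LocStencil (SPerfOf (sfStep Lc) (smStep 3 Lc) S m) Cs' δS' := by
  intro m hm2
  obtain ⟨W, Cw, δw, hδw, hW', h1, hS⟩ := hSm m hm2
  exact locStencil_SPerfOf_rebase_pow hLc2 (le_trans one_le_two hm2) cE cVH cΛ W Cw δw hδw hW' hS

include hr in
/-- **`hWinf` BY REBASE, EVERY `m ≥ 2`, PINNED AT EACH BASE** (`2 ≤ Lc`, `r ∈ box (3+1) Lc`): if each member-`m` column of the (j, m) table family `Wt` (`m ≥ 2`)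
is the REBASED Stage-B table family PINNED AT BASE `Lc^m` (`cE₂ := ((Lc^m:ℕ):ℝ)^(2*(3+1))`, base border `vh₂S 3 (Lc^m)`, mixed table `mixFFAt (toSite r) (Lc^m)`),
then `WPerfOf (sfStep Lc) (smStep 3 Lc) Wt m` is a `VertexFamily₂` at blocking `Lc^m` — the binder `hWinf` of `FP/StepLawKHolds.d1Drift_JsBalOf_of_rows_bounded`.
`SlotRowsPowBase.vertexFamily₂_WPerfOf_rebase_pow` per `m`, root transported by `mem_box_pow`. [our object] composition. -/
theorem hWinf_of_rebase (hLc2 : 2 ≤ Lc)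
    (hWm : ∀ m : ℕ, 2 ≤ m → ∀ j, Wt j m = rebaseW Lc m (WbalOf 3 (Lc ^ m) cE cVH cΛ
      (T2Of 3 (Lc ^ m) cE cVH cΛ (((Lc ^ m : ℕ) : ℝ) ^ (2 * (3 + 1))) cB Tc (vh₂S 3 (Lc ^ m)) (mixFFAt (toSite r) (Lc ^ m)))
      (mixFFAt (toSite r) (Lc ^ m))) j) :
    ∀ m : ℕ, 2 ≤ m → ∃ Cw'' δW' : ℝ, 0 < δW' ∧ VertexFamily₂ (WPerfOf (sfStep Lc) (smStep 3 Lc) Wt m) (Lc ^ m) Cw'' δW' := by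
  intro m hm2
  exact vertexFamily₂_WPerfOf_rebase_pow hLc2 (le_trans one_le_two hm2) (mem_box_pow hr (le_trans one_le_two hm2)) cE cVH cΛ cB Tc
    (hWm m hm2)

/-! ## §2 Road FP's (STEP) socket, END and cell END for the pinned family with the families of record — no class datum, no slot row -/

/-- **THE STEP LAW OF THE PERFECT COEFFICIENT FAMILY, FAMILIES OF RECORD** (`d = 3`, `2 ≤ Lc`, `r ∈ box (3+1) Lc`): `RoadPinnedHolds.fPerf_succ_of_rows_pinned`
with `hSinf` / `hWinf` REPLACED by the rebase equations `hSm` / `hWm` (§1).  REMAINING (displayed): the `m = 1` pins, `hRj`/`hWj` for THIS family, Fubini∞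
`hfub` + `hDA` (N2a), (SDF)∞ `hSDF` (N2b). [our object] composition. -/
theorem fPerf_succ_of_rows_rebased (hLc2 : 2 ≤ Lc)
    (hS1 : ∀ j, S j 1 = (JsBal0Of (one_le_of_two_le hLc2) cE cVH cΛ
      (WbalOf 3 Lc cE cVH cΛ (T2Of 3 Lc cE cVH cΛ ((Lc : ℝ) ^ (2 * (3 + 1))) cB Tc (vh₂S 3 Lc) (mixFFAt (toSite r) Lc)) (mixFFAt (toSite r) Lc))
      (CwOf (one_le_of_two_le hLc2) cE cVH cΛ (T2Of_loc (one_le_of_two_le hLc2) cE cVH cΛ ((Lc : ℝ) ^ (2 * (3 + 1))) cB Tc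
        (hB_base (one_le_of_two_le hLc2)) (hmix_an1 (one_le_of_two_le hLc2) hr)) (hmix_an1 (one_le_of_two_le hLc2) hr))
      (δwOf (one_le_of_two_le hLc2) cE cVH cΛ (T2Of_loc (one_le_of_two_le hLc2) cE cVH cΛ ((Lc : ℝ) ^ (2 * (3 + 1))) cB Tc
        (hB_base (one_le_of_two_le hLc2)) (hmix_an1 (one_le_of_two_le hLc2) hr)) (hmix_an1 (one_le_of_two_le hLc2) hr))
      (δwOf_pos (one_le_of_two_le hLc2) cE cVH cΛ (T2Of_loc (one_le_of_two_le hLc2) cE cVH cΛ ((Lc : ℝ) ^ (2 * (3 + 1))) cB Tc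
        (hB_base (one_le_of_two_le hLc2)) (hmix_an1 (one_le_of_two_le hLc2) hr)) (hmix_an1 (one_le_of_two_le hLc2) hr))
      (WbalOf_loc₂ (one_le_of_two_le hLc2) cE cVH cΛ (T2Of_loc (one_le_of_two_le hLc2) cE cVH cΛ ((Lc : ℝ) ^ (2 * (3 + 1))) cB Tc
        (hB_base (one_le_of_two_le hLc2)) (hmix_an1 (one_le_of_two_le hLc2) hr)) (hmix_an1 (one_le_of_two_le hLc2) hr)) j).S)
    (hW1 : ∀ j, Wt j 1 = WbalOf 3 Lc cE cVH cΛ (T2Of 3 Lc cE cVH cΛ ((Lc : ℝ) ^ (2 * (3 + 1))) cB Tc (vh₂S 3 Lc) (mixFFAt (toSite r) Lc))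
      (mixFFAt (toSite r) Lc) j)
    (hSm : ∀ m : ℕ, 2 ≤ m → ∃ (W : ℕ → Fin (3 + 1) → (Fin (3 + 1) → ℤ) → Fin (3 + 1) → (Fin (3 + 1) → ℤ) → MKer (3 + 1) (Fib 3))
      (Cw δw : ℕ → ℝ) (hδw : ∀ j, 0 < δw j) (hW' : ∀ j, VertexFamily₂ (W j) (Lc ^ m) (Cw j) (δw j)) (h1 : 1 ≤ Lc ^ m),
      ∀ j, S j m = rebaseS Lc m (fun j' => (JsBal0Of h1 cE cVH cΛ W Cw δw hδw hW' j').S) j)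
    (hWm : ∀ m : ℕ, 2 ≤ m → ∀ j, Wt j m = rebaseW Lc m (WbalOf 3 (Lc ^ m) cE cVH cΛ
      (T2Of 3 (Lc ^ m) cE cVH cΛ (((Lc ^ m : ℕ) : ℝ) ^ (2 * (3 + 1))) cB Tc (vh₂S 3 (Lc ^ m)) (mixFFAt (toSite r) (Lc ^ m)))
      (mixFFAt (toSite r) (Lc ^ m))) j)
    (hRj : ∀ j, AxisReflectionCovariant (flipK (TbalOf Lc (JsBalT2Of (one_le_of_two_le hLc2) cE cVH cΛ ((Lc : ℝ) ^ (2 * (3 + 1))) cB Tc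
      (hB_base (one_le_of_two_le hLc2)) (hmix_an1 (one_le_of_two_le hLc2) hr)) j)))
    (hWj : ∀ j, WardTransversal (flipK (TbalOf Lc (JsBalT2Of (one_le_of_two_le hLc2) cE cVH cΛ ((Lc : ℝ) ^ (2 * (3 + 1))) cB Tc
      (hB_base (one_le_of_two_le hLc2)) (hmix_an1 (one_le_of_two_le hLc2) hr)) j)))
    (hDA : ∀ m : ℕ, 1 ≤ m → ∀ a b, AbsMoment₂ (D m a b))
    (hfub : ∀ m : ℕ, 1 ≤ m → ∀ (a b : Fin 4) (z : Fin 4 → ℤ),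
      TPerfOf (Lc ^ (m + 1)) (KPerf Lc (sfStep Lc) (smStep 3 Lc) (m + 1)) (SPerfOf (sfStep Lc) (smStep 3 Lc) S (m + 1))
          (WPerfOf (sfStep Lc) (smStep 3 Lc) Wt (m + 1)) a b z
        = ((Lc ^ m : ℕ) : ℝ) ^ 8 * dressedEntry (colOf (KPerf (d := 3) Lc (sfStep Lc) (smStep 3 Lc) m))
            (TPerfOf Lc (KPerf Lc (sfStep Lc) (smStep 3 Lc) 1) (SPerfOf (sfStep Lc) (smStep 3 Lc) S 1) (WPerfOf (sfStep Lc) (smStep 3 Lc) Wt 1))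
            (((Lc ^ m : ℕ) : ℤ) • z) a b
          + TPerfOf (Lc ^ m) (KPerf Lc (sfStep Lc) (smStep 3 Lc) m) (SPerfOf (sfStep Lc) (smStep 3 Lc) S m) (WPerfOf (sfStep Lc) (smStep 3 Lc) Wt m) a b z
          + D m a b z)
    (μ ν : Fin 4) (hSDF : ∀ m : ℕ, 1 ≤ m → secondMoment (D m) μ ν = 0) :
    ∀ m : ℕ, 1 ≤ m → fPerf Lc (sfStep Lc) (smStep 3 Lc) S Wt μ ν (m + 1) =
      fPerf Lc (sfStep Lc) (smStep 3 Lc) S Wt μ ν m + fPerf Lc (sfStep Lc) (smStep 3 Lc) S Wt μ ν 1 :=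
  fPerf_succ_of_rows_pinned hr cE cVH cΛ cB Tc S Wt hLc2 hS1 hW1 hRj hWj (hSinf_of_rebase cE cVH cΛ S hLc2 hSm)
    (hWinf_of_rebase hr cE cVH cΛ cB Tc Wt hLc2 hWm) hDA hfub μ ν hSDF

/-- **ROAD «FP», THE END FOR THE PINNED FAMILY WITH THE FAMILIES OF RECORD — NO CLASS DATUM, NOTHING FROM ROW G-an2-4 (bounded-defect form)**
(`d = 3`, `2 ≤ Lc`, `r ∈ box (3+1) Lc`): `D1Drift Lc (JsBalT2Of …) N μ ν` ⟸ EXACTLY the `m = 1` pins and the `m ≥ 2` rebase equations (which FIX the families),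
`hRj` (an2's hR) / `hWj` (an1's hW) at finite `j` FOR THIS COMPOSITE FAMILY, Fubini∞ `hfub` + `hDA` (N2a), (SDF)∞ `hSDF` (N2b), bounded-defect asymptotics
`hasym` (N7).  `RoadPinnedHolds.d1Drift_JsBalT2Of_pinned_of_rows_bounded` ∘ §1.  NOT «D1 closed»: every analytic hypothesis named is OPEN. [our object] -/
theorem d1Drift_JsBalT2Of_pinned_of_rows_rebased (hLc2 : 2 ≤ Lc)
    (hS1 : ∀ j, S j 1 = (JsBal0Of (one_le_of_two_le hLc2) cE cVH cΛ
      (WbalOf 3 Lc cE cVH cΛ (T2Of 3 Lc cE cVH cΛ ((Lc : ℝ) ^ (2 * (3 + 1))) cB Tc (vh₂S 3 Lc) (mixFFAt (toSite r) Lc)) (mixFFAt (toSite r) Lc))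
      (CwOf (one_le_of_two_le hLc2) cE cVH cΛ (T2Of_loc (one_le_of_two_le hLc2) cE cVH cΛ ((Lc : ℝ) ^ (2 * (3 + 1))) cB Tc
        (hB_base (one_le_of_two_le hLc2)) (hmix_an1 (one_le_of_two_le hLc2) hr)) (hmix_an1 (one_le_of_two_le hLc2) hr))
      (δwOf (one_le_of_two_le hLc2) cE cVH cΛ (T2Of_loc (one_le_of_two_le hLc2) cE cVH cΛ ((Lc : ℝ) ^ (2 * (3 + 1))) cB Tc
        (hB_base (one_le_of_two_le hLc2)) (hmix_an1 (one_le_of_two_le hLc2) hr)) (hmix_an1 (one_le_of_two_le hLc2) hr))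
      (δwOf_pos (one_le_of_two_le hLc2) cE cVH cΛ (T2Of_loc (one_le_of_two_le hLc2) cE cVH cΛ ((Lc : ℝ) ^ (2 * (3 + 1))) cB Tc
        (hB_base (one_le_of_two_le hLc2)) (hmix_an1 (one_le_of_two_le hLc2) hr)) (hmix_an1 (one_le_of_two_le hLc2) hr))
      (WbalOf_loc₂ (one_le_of_two_le hLc2) cE cVH cΛ (T2Of_loc (one_le_of_two_le hLc2) cE cVH cΛ ((Lc : ℝ) ^ (2 * (3 + 1))) cB Tc
        (hB_base (one_le_of_two_le hLc2)) (hmix_an1 (one_le_of_two_le hLc2) hr)) (hmix_an1 (one_le_of_two_le hLc2) hr)) j).S)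
    (hW1 : ∀ j, Wt j 1 = WbalOf 3 Lc cE cVH cΛ (T2Of 3 Lc cE cVH cΛ ((Lc : ℝ) ^ (2 * (3 + 1))) cB Tc (vh₂S 3 Lc) (mixFFAt (toSite r) Lc))
      (mixFFAt (toSite r) Lc) j)
    (hSm : ∀ m : ℕ, 2 ≤ m → ∃ (W : ℕ → Fin (3 + 1) → (Fin (3 + 1) → ℤ) → Fin (3 + 1) → (Fin (3 + 1) → ℤ) → MKer (3 + 1) (Fib 3))
      (Cw δw : ℕ → ℝ) (hδw : ∀ j, 0 < δw j) (hW' : ∀ j, VertexFamily₂ (W j) (Lc ^ m) (Cw j) (δw j)) (h1 : 1 ≤ Lc ^ m),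
      ∀ j, S j m = rebaseS Lc m (fun j' => (JsBal0Of h1 cE cVH cΛ W Cw δw hδw hW' j').S) j)
    (hWm : ∀ m : ℕ, 2 ≤ m → ∀ j, Wt j m = rebaseW Lc m (WbalOf 3 (Lc ^ m) cE cVH cΛ
      (T2Of 3 (Lc ^ m) cE cVH cΛ (((Lc ^ m : ℕ) : ℝ) ^ (2 * (3 + 1))) cB Tc (vh₂S 3 (Lc ^ m)) (mixFFAt (toSite r) (Lc ^ m)))
      (mixFFAt (toSite r) (Lc ^ m))) j)
    (hRj : ∀ j, AxisReflectionCovariant (flipK (TbalOf Lc (JsBalT2Of (one_le_of_two_le hLc2) cE cVH cΛ ((Lc : ℝ) ^ (2 * (3 + 1))) cB Tc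
      (hB_base (one_le_of_two_le hLc2)) (hmix_an1 (one_le_of_two_le hLc2) hr)) j)))
    (hWj : ∀ j, WardTransversal (flipK (TbalOf Lc (JsBalT2Of (one_le_of_two_le hLc2) cE cVH cΛ ((Lc : ℝ) ^ (2 * (3 + 1))) cB Tc
      (hB_base (one_le_of_two_le hLc2)) (hmix_an1 (one_le_of_two_le hLc2) hr)) j)))
    (hDA : ∀ m : ℕ, 1 ≤ m → ∀ a b, AbsMoment₂ (D m a b))
    (hfub : ∀ m : ℕ, 1 ≤ m → ∀ (a b : Fin 4) (z : Fin 4 → ℤ),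
      TPerfOf (Lc ^ (m + 1)) (KPerf Lc (sfStep Lc) (smStep 3 Lc) (m + 1)) (SPerfOf (sfStep Lc) (smStep 3 Lc) S (m + 1))
          (WPerfOf (sfStep Lc) (smStep 3 Lc) Wt (m + 1)) a b z
        = ((Lc ^ m : ℕ) : ℝ) ^ 8 * dressedEntry (colOf (KPerf (d := 3) Lc (sfStep Lc) (smStep 3 Lc) m))
            (TPerfOf Lc (KPerf Lc (sfStep Lc) (smStep 3 Lc) 1) (SPerfOf (sfStep Lc) (smStep 3 Lc) S 1) (WPerfOf (sfStep Lc) (smStep 3 Lc) Wt 1))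
            (((Lc ^ m : ℕ) : ℤ) • z) a b
          + TPerfOf (Lc ^ m) (KPerf Lc (sfStep Lc) (smStep 3 Lc) m) (SPerfOf (sfStep Lc) (smStep 3 Lc) S m) (WPerfOf (sfStep Lc) (smStep 3 Lc) Wt m) a b z
          + D m a b z)
    (μ ν : Fin 4) (hSDF : ∀ m : ℕ, 1 ≤ m → secondMoment (D m) μ ν = 0) {N Cg : ℝ}
    (hasym : ∀ m : ℕ, 1 ≤ m → |fPerf Lc (sfStep Lc) (smStep 3 Lc) S Wt μ ν m - (m : ℝ) * stepBal N Lc| ≤ Cg) :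
    D1Drift Lc (JsBalT2Of (one_le_of_two_le hLc2) cE cVH cΛ ((Lc : ℝ) ^ (2 * (3 + 1))) cB Tc (hB_base (one_le_of_two_le hLc2))
      (hmix_an1 (one_le_of_two_le hLc2) hr)) N μ ν :=
  d1Drift_JsBalT2Of_pinned_of_rows_bounded hr cE cVH cΛ cB Tc S Wt hLc2 hS1 hW1 hRj hWj (hSinf_of_rebase cE cVH cΛ S hLc2 hSm)
    (hWinf_of_rebase hr cE cVH cΛ cB Tc Wt hLc2 hWm) hDA hfub μ ν hSDF hasym

/-- **THE CELL's END STATEMENT FROM ROAD «FP» FOR THE PINNED FAMILY, FAMILIES OF RECORD**: `EndpointExistence Cn` BY TYPE from the pins, the rebase equations,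
`hRj`/`hWj` (this family), Fubini∞, (SDF)∞, bounded-defect asymptotics, `hβ`, (D4) `RemainderConst` with `rr ≤ stepBal`, (C), `hgen` —
`RoadPinnedHolds.endpointExistence_JsBalT2Of_pinned_of_rows_bounded` ∘ §1.  NOT the continuum limit's construction. [our object] -/
theorem endpointExistence_JsBalT2Of_pinned_of_rows_rebased (hLc2 : 2 ≤ Lc)
    (hS1 : ∀ j, S j 1 = (JsBal0Of (one_le_of_two_le hLc2) cE cVH cΛ
      (WbalOf 3 Lc cE cVH cΛ (T2Of 3 Lc cE cVH cΛ ((Lc : ℝ) ^ (2 * (3 + 1))) cB Tc (vh₂S 3 Lc) (mixFFAt (toSite r) Lc)) (mixFFAt (toSite r) Lc))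
      (CwOf (one_le_of_two_le hLc2) cE cVH cΛ (T2Of_loc (one_le_of_two_le hLc2) cE cVH cΛ ((Lc : ℝ) ^ (2 * (3 + 1))) cB Tc
        (hB_base (one_le_of_two_le hLc2)) (hmix_an1 (one_le_of_two_le hLc2) hr)) (hmix_an1 (one_le_of_two_le hLc2) hr))
      (δwOf (one_le_of_two_le hLc2) cE cVH cΛ (T2Of_loc (one_le_of_two_le hLc2) cE cVH cΛ ((Lc : ℝ) ^ (2 * (3 + 1))) cB Tc
        (hB_base (one_le_of_two_le hLc2)) (hmix_an1 (one_le_of_two_le hLc2) hr)) (hmix_an1 (one_le_of_two_le hLc2) hr))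
      (δwOf_pos (one_le_of_two_le hLc2) cE cVH cΛ (T2Of_loc (one_le_of_two_le hLc2) cE cVH cΛ ((Lc : ℝ) ^ (2 * (3 + 1))) cB Tc
        (hB_base (one_le_of_two_le hLc2)) (hmix_an1 (one_le_of_two_le hLc2) hr)) (hmix_an1 (one_le_of_two_le hLc2) hr))
      (WbalOf_loc₂ (one_le_of_two_le hLc2) cE cVH cΛ (T2Of_loc (one_le_of_two_le hLc2) cE cVH cΛ ((Lc : ℝ) ^ (2 * (3 + 1))) cB Tc
        (hB_base (one_le_of_two_le hLc2)) (hmix_an1 (one_le_of_two_le hLc2) hr)) (hmix_an1 (one_le_of_two_le hLc2) hr)) j).S)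
    (hW1 : ∀ j, Wt j 1 = WbalOf 3 Lc cE cVH cΛ (T2Of 3 Lc cE cVH cΛ ((Lc : ℝ) ^ (2 * (3 + 1))) cB Tc (vh₂S 3 Lc) (mixFFAt (toSite r) Lc))
      (mixFFAt (toSite r) Lc) j)
    (hSm : ∀ m : ℕ, 2 ≤ m → ∃ (W : ℕ → Fin (3 + 1) → (Fin (3 + 1) → ℤ) → Fin (3 + 1) → (Fin (3 + 1) → ℤ) → MKer (3 + 1) (Fib 3))
      (Cw δw : ℕ → ℝ) (hδw : ∀ j, 0 < δw j) (hW' : ∀ j, VertexFamily₂ (W j) (Lc ^ m) (Cw j) (δw j)) (h1 : 1 ≤ Lc ^ m),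
      ∀ j, S j m = rebaseS Lc m (fun j' => (JsBal0Of h1 cE cVH cΛ W Cw δw hδw hW' j').S) j)
    (hWm : ∀ m : ℕ, 2 ≤ m → ∀ j, Wt j m = rebaseW Lc m (WbalOf 3 (Lc ^ m) cE cVH cΛ
      (T2Of 3 (Lc ^ m) cE cVH cΛ (((Lc ^ m : ℕ) : ℝ) ^ (2 * (3 + 1))) cB Tc (vh₂S 3 (Lc ^ m)) (mixFFAt (toSite r) (Lc ^ m)))
      (mixFFAt (toSite r) (Lc ^ m))) j)
    (hRj : ∀ j, AxisReflectionCovariant (flipK (TbalOf Lc (JsBalT2Of (one_le_of_two_le hLc2) cE cVH cΛ ((Lc : ℝ) ^ (2 * (3 + 1))) cB Tc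
      (hB_base (one_le_of_two_le hLc2)) (hmix_an1 (one_le_of_two_le hLc2) hr)) j)))
    (hWj : ∀ j, WardTransversal (flipK (TbalOf Lc (JsBalT2Of (one_le_of_two_le hLc2) cE cVH cΛ ((Lc : ℝ) ^ (2 * (3 + 1))) cB Tc
      (hB_base (one_le_of_two_le hLc2)) (hmix_an1 (one_le_of_two_le hLc2) hr)) j)))
    (hDA : ∀ m : ℕ, 1 ≤ m → ∀ a b, AbsMoment₂ (D m a b))
    (hfub : ∀ m : ℕ, 1 ≤ m → ∀ (a b : Fin 4) (z : Fin 4 → ℤ),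
      TPerfOf (Lc ^ (m + 1)) (KPerf Lc (sfStep Lc) (smStep 3 Lc) (m + 1)) (SPerfOf (sfStep Lc) (smStep 3 Lc) S (m + 1))
          (WPerfOf (sfStep Lc) (smStep 3 Lc) Wt (m + 1)) a b z
        = ((Lc ^ m : ℕ) : ℝ) ^ 8 * dressedEntry (colOf (KPerf (d := 3) Lc (sfStep Lc) (smStep 3 Lc) m))
            (TPerfOf Lc (KPerf Lc (sfStep Lc) (smStep 3 Lc) 1) (SPerfOf (sfStep Lc) (smStep 3 Lc) S 1) (WPerfOf (sfStep Lc) (smStep 3 Lc) Wt 1))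
            (((Lc ^ m : ℕ) : ℤ) • z) a b
          + TPerfOf (Lc ^ m) (KPerf Lc (sfStep Lc) (smStep 3 Lc) m) (SPerfOf (sfStep Lc) (smStep 3 Lc) S m) (WPerfOf (sfStep Lc) (smStep 3 Lc) Wt m) a b z
          + D m a b z)
    (μ ν : Fin 4) (hSDF : ∀ m : ℕ, 1 ≤ m → secondMoment (D m) μ ν = 0) {N Cg : ℝ}
    (hasym : ∀ m : ℕ, 1 ≤ m → |fPerf Lc (sfStep Lc) (smStep 3 Lc) S Wt μ ν m - (m : ℝ) * stepBal N Lc| ≤ Cg)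
    {β : HBeta} {Cn : B12.Construction} (hgen : ForwardGenerated Cn β) (Sβ : B12Beta.OneLoopSplit β)
    (hβ : ∀ j, Sβ.β0 j = B12Beta.secondMoment (TbalOf Lc (JsBalT2Of (one_le_of_two_le hLc2) cE cVH cΛ ((Lc : ℝ) ^ (2 * (3 + 1))) cB Tc
      (hB_base (one_le_of_two_le hLc2)) (hmix_an1 (one_le_of_two_le hLc2) hr)) j) μ ν)
    {rr γ₀ : ℝ} (hγ₀ : 0 < γ₀) (hrem : RemainderConst Sβ γ₀ rr) (hr' : rr ≤ stepBal N Lc) (hcont : BetaContH γ₀ β) :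
    EndpointExistence Cn :=
  endpointExistence_JsBalT2Of_pinned_of_rows_bounded hr cE cVH cΛ cB Tc S Wt hLc2 hS1 hW1 hRj hWj (hSinf_of_rebase cE cVH cΛ S hLc2 hSm)
    (hWinf_of_rebase hr cE cVH cΛ cB Tc Wt hLc2 hWm) hDA hfub μ ν hSDF hasym hgen Sβ hβ hγ₀ hrem hr' hcont

/-! ## §3 Non-vacuity: the families of record exist -/

/-- **THE (j, m) JET FAMILIES OF RECORD EXIST** (`2 ≤ Lc`, `r ∈ box (3+1) Lc`): there are families `S`, `Wt` whose member `1` is the base-`Lc` pinned wall family's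
first-order stencils / second-order tables (the pins `hS1` / `hW1` of §2) and whose member `m ≥ 2` is the rebased Stage-B wall family PINNED AT BASE `Lc^m` (the rebase
equations `hSm` / `hWm` of §2) — defined by cases on `m`; so §2's hypothesis shape is inhabited and FIXES the families.  [our object] bookkeeping. -/
theorem exists_rebased_families (hLc2 : 2 ≤ Lc) :
    ∃ (S : ℕ → ℕ → Fin (3 + 1) → (Fin (3 + 1) → ℤ) → MKer (3 + 1) (Fib 3))
      (Wt : ℕ → ℕ → Fin (3 + 1) → (Fin (3 + 1) → ℤ) → Fin (3 + 1) → (Fin (3 + 1) → ℤ) → MKer (3 + 1) (Fib 3)),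
      (∀ j, S j 1 = (JsBal0Of (one_le_of_two_le hLc2) cE cVH cΛ
        (WbalOf 3 Lc cE cVH cΛ (T2Of 3 Lc cE cVH cΛ ((Lc : ℝ) ^ (2 * (3 + 1))) cB Tc (vh₂S 3 Lc) (mixFFAt (toSite r) Lc)) (mixFFAt (toSite r) Lc))
        (CwOf (one_le_of_two_le hLc2) cE cVH cΛ (T2Of_loc (one_le_of_two_le hLc2) cE cVH cΛ ((Lc : ℝ) ^ (2 * (3 + 1))) cB Tc
          (hB_base (one_le_of_two_le hLc2)) (hmix_an1 (one_le_of_two_le hLc2) hr)) (hmix_an1 (one_le_of_two_le hLc2) hr))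
        (δwOf (one_le_of_two_le hLc2) cE cVH cΛ (T2Of_loc (one_le_of_two_le hLc2) cE cVH cΛ ((Lc : ℝ) ^ (2 * (3 + 1))) cB Tc
          (hB_base (one_le_of_two_le hLc2)) (hmix_an1 (one_le_of_two_le hLc2) hr)) (hmix_an1 (one_le_of_two_le hLc2) hr))
        (δwOf_pos (one_le_of_two_le hLc2) cE cVH cΛ (T2Of_loc (one_le_of_two_le hLc2) cE cVH cΛ ((Lc : ℝ) ^ (2 * (3 + 1))) cB Tc
          (hB_base (one_le_of_two_le hLc2)) (hmix_an1 (one_le_of_two_le hLc2) hr)) (hmix_an1 (one_le_of_two_le hLc2) hr))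
        (WbalOf_loc₂ (one_le_of_two_le hLc2) cE cVH cΛ (T2Of_loc (one_le_of_two_le hLc2) cE cVH cΛ ((Lc : ℝ) ^ (2 * (3 + 1))) cB Tc
          (hB_base (one_le_of_two_le hLc2)) (hmix_an1 (one_le_of_two_le hLc2) hr)) (hmix_an1 (one_le_of_two_le hLc2) hr)) j).S) ∧
      (∀ j, Wt j 1 = WbalOf 3 Lc cE cVH cΛ (T2Of 3 Lc cE cVH cΛ ((Lc : ℝ) ^ (2 * (3 + 1))) cB Tc (vh₂S 3 Lc) (mixFFAt (toSite r) Lc))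
        (mixFFAt (toSite r) Lc) j) ∧
      (∀ m : ℕ, 2 ≤ m → ∃ (W : ℕ → Fin (3 + 1) → (Fin (3 + 1) → ℤ) → Fin (3 + 1) → (Fin (3 + 1) → ℤ) → MKer (3 + 1) (Fib 3))
        (Cw δw : ℕ → ℝ) (hδw : ∀ j, 0 < δw j) (hW' : ∀ j, VertexFamily₂ (W j) (Lc ^ m) (Cw j) (δw j)) (h1 : 1 ≤ Lc ^ m),
        ∀ j, S j m = rebaseS Lc m (fun j' => (JsBal0Of h1 cE cVH cΛ W Cw δw hδw hW' j').S) j) ∧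
      (∀ m : ℕ, 2 ≤ m → ∀ j, Wt j m = rebaseW Lc m (WbalOf 3 (Lc ^ m) cE cVH cΛ
        (T2Of 3 (Lc ^ m) cE cVH cΛ (((Lc ^ m : ℕ) : ℝ) ^ (2 * (3 + 1))) cB Tc (vh₂S 3 (Lc ^ m)) (mixFFAt (toSite r) (Lc ^ m)))
        (mixFFAt (toSite r) (Lc ^ m))) j) := by
  classical
  -- the base-`Lc^m` pinned data (proof terms packaged once per `m`; `m = 1` gives the base-`Lc` family since `Lc^1 = Lc` is NOT used — member 1 is
  -- taken verbatim from the base-`Lc` family)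
  have hpow : ∀ m : ℕ, 2 ≤ m → 1 ≤ Lc ^ m := fun m hm => one_le_of_two_le (two_le_pow hLc2 (le_trans one_le_two hm))
  have hbox : ∀ m : ℕ, 2 ≤ m → r ∈ box (3 + 1) (Lc ^ m) := fun m hm => mem_box_pow hr (le_trans one_le_two hm)
  refine ⟨fun j m => if hm : 2 ≤ m then
      rebaseS Lc m (fun j' => (JsBal0Of (hpow m hm) cE cVH cΛ
        (WbalOf 3 (Lc ^ m) cE cVH cΛ (T2Of 3 (Lc ^ m) cE cVH cΛ (((Lc ^ m : ℕ) : ℝ) ^ (2 * (3 + 1))) cB Tc (vh₂S 3 (Lc ^ m))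
          (mixFFAt (toSite r) (Lc ^ m))) (mixFFAt (toSite r) (Lc ^ m)))
        (CwOf (hpow m hm) cE cVH cΛ (T2Of_loc (hpow m hm) cE cVH cΛ (((Lc ^ m : ℕ) : ℝ) ^ (2 * (3 + 1))) cB Tc
          (hB_base (hpow m hm)) (hmix_an1 (hpow m hm) (hbox m hm))) (hmix_an1 (hpow m hm) (hbox m hm)))
        (δwOf (hpow m hm) cE cVH cΛ (T2Of_loc (hpow m hm) cE cVH cΛ (((Lc ^ m : ℕ) : ℝ) ^ (2 * (3 + 1))) cB Tc
          (hB_base (hpow m hm)) (hmix_an1 (hpow m hm) (hbox m hm))) (hmix_an1 (hpow m hm) (hbox m hm)))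
        (δwOf_pos (hpow m hm) cE cVH cΛ (T2Of_loc (hpow m hm) cE cVH cΛ (((Lc ^ m : ℕ) : ℝ) ^ (2 * (3 + 1))) cB Tc
          (hB_base (hpow m hm)) (hmix_an1 (hpow m hm) (hbox m hm))) (hmix_an1 (hpow m hm) (hbox m hm)))
        (WbalOf_loc₂ (hpow m hm) cE cVH cΛ (T2Of_loc (hpow m hm) cE cVH cΛ (((Lc ^ m : ℕ) : ℝ) ^ (2 * (3 + 1))) cB Tc
          (hB_base (hpow m hm)) (hmix_an1 (hpow m hm) (hbox m hm))) (hmix_an1 (hpow m hm) (hbox m hm))) j').S) j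
    else
      (JsBal0Of (one_le_of_two_le hLc2) cE cVH cΛ
        (WbalOf 3 Lc cE cVH cΛ (T2Of 3 Lc cE cVH cΛ ((Lc : ℝ) ^ (2 * (3 + 1))) cB Tc (vh₂S 3 Lc) (mixFFAt (toSite r) Lc)) (mixFFAt (toSite r) Lc))
        (CwOf (one_le_of_two_le hLc2) cE cVH cΛ (T2Of_loc (one_le_of_two_le hLc2) cE cVH cΛ ((Lc : ℝ) ^ (2 * (3 + 1))) cB Tc
          (hB_base (one_le_of_two_le hLc2)) (hmix_an1 (one_le_of_two_le hLc2) hr)) (hmix_an1 (one_le_of_two_le hLc2) hr))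
        (δwOf (one_le_of_two_le hLc2) cE cVH cΛ (T2Of_loc (one_le_of_two_le hLc2) cE cVH cΛ ((Lc : ℝ) ^ (2 * (3 + 1))) cB Tc
          (hB_base (one_le_of_two_le hLc2)) (hmix_an1 (one_le_of_two_le hLc2) hr)) (hmix_an1 (one_le_of_two_le hLc2) hr))
        (δwOf_pos (one_le_of_two_le hLc2) cE cVH cΛ (T2Of_loc (one_le_of_two_le hLc2) cE cVH cΛ ((Lc : ℝ) ^ (2 * (3 + 1))) cB Tc
          (hB_base (one_le_of_two_le hLc2)) (hmix_an1 (one_le_of_two_le hLc2) hr)) (hmix_an1 (one_le_of_two_le hLc2) hr))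
        (WbalOf_loc₂ (one_le_of_two_le hLc2) cE cVH cΛ (T2Of_loc (one_le_of_two_le hLc2) cE cVH cΛ ((Lc : ℝ) ^ (2 * (3 + 1))) cB Tc
          (hB_base (one_le_of_two_le hLc2)) (hmix_an1 (one_le_of_two_le hLc2) hr)) (hmix_an1 (one_le_of_two_le hLc2) hr)) j).S,
    fun j m => if 2 ≤ m then
      rebaseW Lc m (WbalOf 3 (Lc ^ m) cE cVH cΛ
        (T2Of 3 (Lc ^ m) cE cVH cΛ (((Lc ^ m : ℕ) : ℝ) ^ (2 * (3 + 1))) cB Tc (vh₂S 3 (Lc ^ m)) (mixFFAt (toSite r) (Lc ^ m)))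
        (mixFFAt (toSite r) (Lc ^ m))) j
    else
      WbalOf 3 Lc cE cVH cΛ (T2Of 3 Lc cE cVH cΛ ((Lc : ℝ) ^ (2 * (3 + 1))) cB Tc (vh₂S 3 Lc) (mixFFAt (toSite r) Lc)) (mixFFAt (toSite r) Lc) j,
    ?_, ?_, ?_, ?_⟩
  · exact fun j => dif_neg (by omega)
  · exact fun j => if_neg (by omega)
  · intro m hm
    exact ⟨_, _, _, _, _, hpow m hm, fun j => dif_pos hm⟩
  · exact fun m hm j => if_pos hm

end

end Summit.QuantumFields.BalabanUV.Beta.FP.RoadRebasedHolds
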